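import Literature.NumberTheory.Automorphic.QuadraticHeckeCharacterLocalComponent
import Literature.NumberTheory.Automorphic.QuadraticHeckeCharacterArchComponent
import Literature.NumberTheory.QuadraticForms.NormIndexSecondInequalityProofs
import HarnessLib

/-!
# O'Meara's product formula for the quadratic Hecke character: `ω(𝔦) = ∏_𝔭 (𝔦_𝔭, θ)_𝔭`

Topic `NumberTheory/Automorphic`; namespace `Literature.NumberTheory.Automorphic`. Everything here is proved.

For a number field `K`, a non-square `θ ∈ 𝓞 K` and the quadratic Hecke character
`ω = quadraticHeckeChar K θ` of `K(√θ)/K` (`QuadraticHeckeCharacter.lean`: the sign character of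
`P_K · N_{K(√θ)/K} J = principalIdeles K ⊔ normIdeles K θ`), the files
`QuadraticHeckeCharacterLocalComponent.lean` / `QuadraticHeckeCharacterArchComponent.lean` computed `ω` on the
one-place idèles: `ω(⟨c⟩_v) = (c, θ)_v` at every place. Here:

* `finite_setOf_ideleFiniteComponent_not_mem` — for an idèle `𝔦`, the finite places `v` where `𝔦_v` is NOT a
  local norm from `K_v(√θ)` form a finite set (contained in: `v ∣ 2`, `v(θ) ≠ 0`, `v(𝔦_v) ≠ 0` — O'Meara 63:16 /
  Example 65:4: units are norms at the other places, the tree's `OMeara65.mem_quadraticNormSubgroup_of_valued_eq_one`);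
  `finite_mulSupport_hilbertSymbol_idele` — so `v ↦ (𝔦_v, θ)_v` has finite multiplicative support;
* `quadraticHeckeChar_eq_finprod_mul_prod` — **O'Meara's formula** (proof of Thm. 71:19, the DEFINITION
  "`φ(𝔦) = ∏_{𝔭 ∈ Ω} (𝔦_𝔭, β / 𝔭)`" of the character there): for EVERY idèle `𝔦`,
  `ω(𝔦) = ∏ᶠ_{v finite} (𝔦_v, θ)_v · ∏_{w ∣ ∞} (𝔦_w, θ)_w`. Proof: `𝔦 = s · t · r` with
  `s = ∏_{v ∈ T} ⟨𝔦_v⟩_v` over the finite exceptional set `T`, `t = ∏_w ⟨𝔦_w⟩_w`, and `r` a norm idèle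
  (killed by `ω`); then the one-place formulas. So the sign character of the index-two subgroup of 65:21 IS
  O'Meara's `φ`, i.e. the product of the local norm-residue symbols (the explicit reciprocity-law description
  of the quadratic Artin character).

Provenance: tree-vocabulary form of the `pub-hodgecm` package theorem
`NumberField.coe_quadraticCharacterIdele_eq_finprod_mul_prod` (`HodgeCM/Literature/QuadraticCharacterLocal.lean`,
gen 6, gate run 27), re-proved over the tree's `quadraticHeckeChar`, `localUnits`, `infiniteIdeleSingle`.

## References

* O. T. O'Meara, *Introduction to Quadratic Forms*, Grundlehren 117 (1963), §63C (63:16), §65A (Examples 65:2,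
  65:4), §71D proof of Thm. 71:19 (the formula for `φ`). [Omeara1963]
-/

noncomputable section

open scoped NumberField
open NumberField IsDedekindDomain

namespace Literature.NumberTheory.Automorphic

open QuadraticForms GaloisRepresentations

variable (K : Type) [Field K] [NumberField K]

/-- The finite places where `v(c) ≠ 0` (`c ≠ 0`) form a finite set (supports of `c` and `c⁻¹`). [folklore] -/
private theorem finite_setOf_valuation_ne_one' {c : K} (hc : c ≠ 0) :
    {v : HeightOneSpectrum (𝓞 K) | v.valuation K c ≠ 1}.Finite := by
  refine ((HeightOneSpectrum.Support.finite (𝓞 K) c).union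
    (HeightOneSpectrum.Support.finite (𝓞 K) c⁻¹)).subset fun v hv ↦ ?_
  simp only [Set.mem_setOf_eq, Set.mem_union, HeightOneSpectrum.Support, map_inv₀] at hv ⊢
  rcases hv.lt_or_gt with h | h
  · exact Or.inr ((one_lt_inv₀ ((Valuation.pos_iff _).mpr hc)).mpr h)
  · exact Or.inl h

/-- **Almost all components of an idèle are local norms**: for `a ≠ 0` and an idèle `𝔦`, the finite places `v`
with `𝔦_v ∉ N(K_v(√a)ˣ)` form a finite set (they are among the dyadic places, the places where `a` is not a unit,
and the places where `𝔦_v` is not a unit — O'Meara 63:16 / Example 65:4). [cite: Omeara1963, §65A Example 65:4] -/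
theorem finite_setOf_ideleFiniteComponent_not_mem {a : K} (ha0 : a ≠ 0) (x : ideleGroup K) :
    {v : HeightOneSpectrum (𝓞 K) | ideleFiniteComponent K v x ∉
        quadraticNormSubgroup (v.adicCompletion K) (algebraMap K _ a)}.Finite := by
  have h := FiniteAdeleRing.unitsEquiv_finite_valued_eq_one
    (Units.map (RingHom.snd (InfiniteAdeleRing K) (FiniteAdeleRing (𝓞 K) K) :
      AdeleRing (𝓞 K) K →+* FiniteAdeleRing (𝓞 K) K).toMonoidHom x)
  refine (((Filter.eventually_cofinite.mp h).union (OMeara65.finite_setOf_two_mem K)).union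
    (finite_setOf_valuation_ne_one' K ha0)).subset fun v hv => ?_
  by_contra hnot
  simp only [Set.mem_union, Set.mem_setOf_eq, not_or, not_not] at hnot
  obtain ⟨⟨hx1, h2⟩, hav⟩ := hnot
  change Valued.v ((x : AdeleRing (𝓞 K) K).2 v) = 1 at hx1
  exact hv (OMeara65.mem_quadraticNormSubgroup_of_valued_eq_one v h2 hav (t := ideleFiniteComponent K v x) hx1)

/-- If `𝔦_v` is a local norm then `(𝔦_v, a)_v = 1`. [cite: Omeara1963, §65A (before Example 65:1)] -/
theorem hilbertSymbol_ideleComponent_eq_one_of_mem {a : K} (ha0 : a ≠ 0) {x : ideleGroup K}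
    {v : HeightOneSpectrum (𝓞 K)}
    (hmem : ideleFiniteComponent K v x ∈ quadraticNormSubgroup (v.adicCompletion K) (algebraMap K _ a)) :
    hilbertSymbol (v.adicCompletion K) ((x : AdeleRing (𝓞 K) K).2 v) (algebraMap K _ a) = 1 := by
  haveI : CharZero (v.adicCompletion K) := charZero_of_injective_algebraMap (algebraMap K _).injective
  have h1 := (hilbertSymbol_eq_one_iff_mem_quadraticNormSubgroup (F := v.adicCompletion K)
    ((map_ne_zero (algebraMap K (v.adicCompletion K))).2 ha0) (ideleFiniteComponent K v x)).2 hmem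
  rwa [val_ideleFiniteComponent] at h1

/-- Hence `(𝔦_v, a)_v = 1` for all but finitely many `v`: `v ↦ (𝔦_v, a)_v ∈ ℂ` has finite multiplicative support.
[cite: Omeara1963, §65A Example 65:4] -/
theorem finite_mulSupport_hilbertSymbol_idele {a : K} (ha0 : a ≠ 0) (x : ideleGroup K) :
    (Function.mulSupport fun v : HeightOneSpectrum (𝓞 K) =>
      (hilbertSymbol (v.adicCompletion K) ((x : AdeleRing (𝓞 K) K).2 v) (algebraMap K _ a) : ℂ)).Finite := by
  refine (finite_setOf_ideleFiniteComponent_not_mem K ha0 x).subset fun v hv => ?_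
  rw [Function.mem_mulSupport] at hv
  rw [Set.mem_setOf_eq]
  intro hmem
  exact hv (by rw [hilbertSymbol_ideleComponent_eq_one_of_mem K ha0 hmem, Int.cast_one])

variable {K}

/-- **O'Meara's formula `ω(𝔦) = ∏_𝔭 (𝔦_𝔭, θ)_𝔭`** (the definition of `φ` in the proof of Thm. 71:19) for the quadratic
Hecke character `ω = quadraticHeckeChar K θ`: for every idèle `𝔦`,
`ω(𝔦) = ∏ᶠ_{v finite} (𝔦_v, θ)_v · ∏_{w infinite} (𝔦_w, θ)_w`, the first product having finitely many factors
`≠ 1` (`finite_mulSupport_hilbertSymbol_idele`). [cite: Omeara1963, §71D proof of Thm. 71:19] -/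
theorem quadraticHeckeChar_eq_finprod_mul_prod {θ : 𝓞 K} (hθ : ¬ IsSquare (θ : K)) (x : ideleGroup K) :
    ((quadraticHeckeChar K θ hθ x : ℂˣ) : ℂ) =
      (∏ᶠ v : HeightOneSpectrum (𝓞 K),
          (hilbertSymbol (v.adicCompletion K) ((x : AdeleRing (𝓞 K) K).2 v) (algebraMap K _ (θ : K)) : ℂ)) *
        ∏ w : InfinitePlace K,
          (hilbertSymbol w.Completion ((x : AdeleRing (𝓞 K) K).1 w) (algebraMap K _ (θ : K)) : ℂ) := by
  classical
  have hθ0 : (θ : K) ≠ 0 := by exact_mod_cast RingOfIntegers.ne_zero_of_not_isSquare K hθ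
  set T := (finite_setOf_ideleFiniteComponent_not_mem K hθ0 x).toFinset with hT
  have hTmem : ∀ v, v ∈ T ↔ ideleFiniteComponent K v x ∉
      quadraticNormSubgroup (v.adicCompletion K) (algebraMap K _ (θ : K)) := fun v => by
    rw [hT, Set.Finite.mem_toFinset, Set.mem_setOf_eq]
  -- the finite-place part `s` and the archimedean part `t`
  set s : ideleGroup K := ∏ v ∈ T, localUnits v (ideleFiniteComponent K v x) with hs
  set t : ideleGroup K := ∏ w : InfinitePlace K, infiniteIdeleSingle w (ideleInfiniteComponent K w x) with ht
  -- components of `s` and `t`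
  have hs_fin_mem : ∀ u ∈ T, ideleFiniteComponent K u s = ideleFiniteComponent K u x := fun u hu => by
    rw [hs, map_prod, Finset.prod_eq_single u (fun v _ hvu => ideleFiniteComponent_localUnits_of_ne K _ (Ne.symm hvu))
      (fun h => absurd hu h), ideleFiniteComponent_localUnits_self]
  have hs_fin_nmem : ∀ u ∉ T, ideleFiniteComponent K u s = 1 := fun u hu => by
    rw [hs, map_prod]
    refine Finset.prod_eq_one fun v hv => ideleFiniteComponent_localUnits_of_ne K _ ?_
    rintro rfl
    exact hu hv
  have hs_inf : ∀ w : InfinitePlace K, ideleInfiniteComponent K w s = 1 := fun w => by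
    rw [hs, map_prod]
    exact Finset.prod_eq_one fun v _ => ideleInfiniteComponent_localUnits K v _ w
  have ht_fin : ∀ u : HeightOneSpectrum (𝓞 K), ideleFiniteComponent K u t = 1 := fun u => by
    rw [ht, map_prod]
    exact Finset.prod_eq_one fun w _ => ideleFiniteComponent_infiniteIdeleSingle K w _ u
  have ht_inf : ∀ w : InfinitePlace K, ideleInfiniteComponent K w t = ideleInfiniteComponent K w x := fun w => by
    rw [ht, map_prod, Finset.prod_eq_single w
      (fun w' _ hw' => ideleInfiniteComponent_infiniteIdeleSingle_of_ne K _ (Ne.symm hw'))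
      (fun h => absurd (Finset.mem_univ w) h), ideleInfiniteComponent_infiniteIdeleSingle_self]
  -- the remainder `r = x (s t)⁻¹` is a norm idèle
  have hr : x * (s * t)⁻¹ ∈ normIdeles K (θ : K) := by
    refine mem_normIdeles_iff.2 ⟨fun u => ?_, fun w => ?_⟩
    · rw [map_mul, map_inv, map_mul, ht_fin, mul_one]
      by_cases hu : u ∈ T
      · rw [hs_fin_mem u hu, mul_inv_cancel]
        exact Subgroup.one_mem _
      · rw [hs_fin_nmem u hu, inv_one, mul_one]
        exact not_not.1 ((hTmem u).not.1 hu)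
    · rw [map_mul, map_inv, map_mul, hs_inf, one_mul, ht_inf, mul_inv_cancel]
      exact Subgroup.one_mem _
  have hx : x = s * t * (x * (s * t)⁻¹) := (mul_inv_cancel_comm_assoc (s * t) x).symm
  conv_lhs => rw [hx]
  rw [map_mul, map_mul, quadraticHeckeChar_apply_of_mem hθ (Subgroup.mem_sup_right hr), mul_one, Units.val_mul]
  congr 1
  · -- the finite places: `ω(s) = ∏_{v ∈ T} (x_v, θ)_v = ∏ᶠ_v (x_v, θ)_v`
    rw [hs, map_prod, Units.coe_prod, finprod_eq_prod_of_mulSupport_subset _ (s := T) ?_]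
    · refine Finset.prod_congr rfl fun v _ => ?_
      rw [quadraticHeckeChar_localUnits, val_ideleFiniteComponent]
    · intro v hv
      rw [Finset.mem_coe, hTmem]
      intro hmem
      exact hv (by dsimp only; rw [hilbertSymbol_ideleComponent_eq_one_of_mem K hθ0 hmem, Int.cast_one])
  · -- the infinite places: `ω(t) = ∏_w (x_w, θ)_w`
    rw [ht, map_prod, Units.coe_prod]
    refine Finset.prod_congr rfl fun w _ => ?_
    rw [quadraticHeckeChar_infiniteIdeleSingle, val_ideleInfiniteComponent]

end Literature.NumberTheory.Automorphic

end
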